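import Literature.AnabelianGeometry.SemiGraphs.Example28CoverticialLoopCounterexample
import Literature.AnabelianGeometry.SemiGraphs.Example28CoverticialNecessity
import HarnessLib

/-!
# [SemiAnbd] Example 2.8, coverticial half — the REPAIRED statement (F-1474, finding d075-S1)

Mochizuki, *Semi-graphs of anabelioids*, Publ. RIMS **42** (2006) 221–322, §2, Example 2.8, author's
manuscript p. 31 [cite: MochizukiSemiAnbd2006, Ex. 2.8 p.31]: if `𝒢_e` is trivial for all edges `e`,
"a closed edge abutting to vertices `v`, `w` is sub-coverticial (respectively, universally
sub-coverticial) if and only if both `Π_v` and `Π_w` are nontrivial (respectively, infinite)."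

The tree's first rendering `SemiGraphOfAnabelioids.example_2_8_coverticial` (`Coverticial.lean`,
FACT-LIST F-1474) quantifies over `𝒢.graph.Joins e v w`, which allows a LOOP (`v = w`, p. 11 "(not
necessarily distinct)"); at a loop with `Π_v = 1` the biconditional fails — finding d075-S1
(abc-iut-w4-d075), KERNEL-REFUTED by `not_example_2_8_coverticial`
(`Example28CoverticialLoopCounterexample.lean`, abc-iut-w4-d079).  This file (statement owner
abc-iut-L3-t1; ruling α42 of abc-iut-L3-lead: "file the REPAIRED statement as a NEW decl … never an
in-place edit") types the repaired named fact as a NEW declaration and proves the parts of it the tree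
already has:

* `example_2_8_coverticial'` — NAMED FACT, the repaired statement: for CONNECTED `𝒢` (§2 standing
  assumption, p. 22) with trivial edge anabelioids and a closed edge `e` joining `v`, `w`: (1) if
  `v ≠ w`, "`e` sub-coverticial ↔ `Π_v`, `Π_w` nontrivial"; (1′) if `v = w` (a loop), `e` IS
  sub-coverticial; (2) "`e` universally sub-coverticial ↔ `Π_v`, `Π_w` infinite" as printed;
* `example_2_8_coverticial'_loop` — clause (1′) HOLDS (`isSubCoverticial_of_loop`, abc-iut-w4-d079);
  clause (1) HOLDS for `v ≠ w` by `isSubCoverticial_iff_of_ne` (`Example28CoverticialNecessity.lean`,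
  abc-iut-w4-d079) — cited by name;
* `example_2_8_coverticial'_of` — the fact REDUCES to clause (2) ("universally sub-coverticial ↔
  `Π_v`, `Π_w` infinite"), whose "if" is `isUniversallySubCoverticial_of_infinite`
  (`Example28CoverticialUniversal.lean`) and whose "only if" is in progress (abc-iut-w4-d079).

OPEN (so `example_2_8_coverticial'` stays a named fact): clause (2), "only if".
No statement of `Coverticial.lean` is altered; nothing here takes a side on [IUTchIII] Cor. 3.12.
-/

namespace Literature.AnabelianGeometry.SemiGraphs

open CategoryTheory CategoryTheory.Limits CategoryTheory.PreGaloisCategory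
open Literature.AnabelianGeometry.Anabelioids

universe v₁ u₁ u

namespace SemiGraphOfAnabelioids

/-- NAMED FACT, [SemiAnbd] Example 2.8, coverticial half — REPAIRED STATEMENT (replaces, for
consumers, `example_2_8_coverticial`, which is false as typed at a loop, finding d075-S1 /
`not_example_2_8_coverticial`): for `𝒢` connected (the standing assumption of §2, p. 22 "Let `𝒢` be
a connected semi-graph of anabelioids", under which the finite étale coverings of Definition 2.2 (i)
are defined), if `𝒢_e` is trivial for all edges `e`, "a closed edge abutting to vertices `v`, `w` is
sub-coverticial (respectively, universally sub-coverticial) if and only if both `Π_v` and `Π_w` are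
nontrivial (respectively, infinite)" — the sub-coverticial criterion for two DISTINCT vertices
`v ≠ w`; a loop (`v = w`, allowed: p. 11 "(not necessarily distinct) elements `v₁`, `v₂`") with
trivial `𝒢_e` is ALWAYS sub-coverticial (the object `1 ⊔ 1` of `B(𝒢)` glued by the swap along one
branch of `e` gives a covering whose two edges over `e` both abut to the same two vertices over `v`,
pp. 12–13); the universally-sub-coverticial criterion is recorded as printed for all `v`, `w`.
[cite: MochizukiSemiAnbd2006, Ex. 2.8 p.31] -/
def example_2_8_coverticial' : Prop :=
  ∀ (𝒢 : SemiGraphOfAnabelioids.{v₁, u₁, u}), 𝒢.IsConnected → 𝒢.HasTrivialEdgeAnabelioids →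
    ∀ (e : 𝒢.graph.Edge) (v w : 𝒢.graph.Vertex), 𝒢.graph.Joins e v w →
      (v ≠ w → (𝒢.IsSubCoverticial e ↔
        (∀ (F : 𝒢.V v ⥤ FintypeCat.{v₁}) [FiberFunctor F], Nontrivial (Aut F)) ∧
          ∀ (F : 𝒢.V w ⥤ FintypeCat.{v₁}) [FiberFunctor F], Nontrivial (Aut F))) ∧
      (v = w → 𝒢.IsSubCoverticial e) ∧
      (𝒢.IsUniversallySubCoverticial e ↔
        (∀ (F : 𝒢.V v ⥤ FintypeCat.{v₁}) [FiberFunctor F], Infinite (Aut F)) ∧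
          ∀ (F : 𝒢.V w ⥤ FintypeCat.{v₁}) [FiberFunctor F], Infinite (Aut F))

variable {𝒢 : SemiGraphOfAnabelioids.{v₁, u₁, u}}

/-- **Clause (1′) of the repaired Example 2.8 HOLDS**: with trivial edge anabelioids, a closed edge
joining `v` to itself (a loop) is sub-coverticial (`isSubCoverticial_of_loop`, abc-iut-w4-d079: the
double covering swapped along one branch). [cite: MochizukiSemiAnbd2006, Ex. 2.8 p.31] -/
theorem example_2_8_coverticial'_loop (hE : 𝒢.HasTrivialEdgeAnabelioids) {e : 𝒢.graph.Edge}
    {v : 𝒢.graph.Vertex} (hj : 𝒢.graph.Joins e v v) : 𝒢.IsSubCoverticial e := by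
  obtain ⟨b₁, b₂, hne, he₁, he₂, h₁, h₂⟩ := hj
  exact isSubCoverticial_of_loop hE hne he₁ he₂ h₁ h₂

/-- The repaired statement reduces to clause (2): granted "universally sub-coverticial ↔ `Π_v` and
`Π_w` infinite" (its "if" is `isUniversallySubCoverticial_of_infinite` of
`Example28CoverticialUniversal.lean`), `example_2_8_coverticial'` holds — clause (1) for `v ≠ w`
(`isSubCoverticial_iff_of_ne`) and the loop clause (1′) (`isSubCoverticial_of_loop`) being theorems
of the tree. [cite: MochizukiSemiAnbd2006, Ex. 2.8 p.31] -/
theorem example_2_8_coverticial'_of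
    (huniv : ∀ (𝒢 : SemiGraphOfAnabelioids.{v₁, u₁, u}), 𝒢.IsConnected →
      𝒢.HasTrivialEdgeAnabelioids → ∀ (e : 𝒢.graph.Edge) (v w : 𝒢.graph.Vertex),
        𝒢.graph.Joins e v w →
          (𝒢.IsUniversallySubCoverticial e ↔
            (∀ (F : 𝒢.V v ⥤ FintypeCat.{v₁}) [FiberFunctor F], Infinite (Aut F)) ∧
              ∀ (F : 𝒢.V w ⥤ FintypeCat.{v₁}) [FiberFunctor F], Infinite (Aut F))) :
    example_2_8_coverticial'.{v₁, u₁, u} := by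
  intro 𝒢 hc hE e v w hj
  refine ⟨fun hvw => isSubCoverticial_iff_of_ne hE hj hvw, fun hvw => ?_, huniv 𝒢 hc hE e v w hj⟩
  subst hvw
  exact example_2_8_coverticial'_loop hE hj

end SemiGraphOfAnabelioids

end Literature.AnabelianGeometry.SemiGraphs
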